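import Literature.NumberTheory.Transcendental.DyadicRamifiedCharts
import Literature.Analysis.Calculus.MonomialUnits
import Mathlib.RingTheory.Polynomial.Resultant.Basic
import Mathlib.Analysis.Analytic.Polynomial
import Mathlib.Analysis.Complex.Polynomial.Basic
import HarnessLib

/-!
# Jung's projection method: the prepared base chart
# (dyadic localisation, Abhyankar–Jung ramification, simple analytic roots)

Fix a monic `P ∈ ℚ[x][T]` of degree `n` with
`D = Res_T(P, P') ∈ ℚ[x]`, a base chart `φ : ℝᵈ → ℝᵈ` of the tree's FORMAT along which `D` is a
cube-monomial times a unit (the output of `E(d)` applied to `{D}`), and a corner `c ∈ {0,1}ᵈ`.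
`exists_base_chart` produces, ASSUMING the Abhyankar–Jung statement `AJ(d)` of the skeleton: a
ramification exponent `N ≥ 1`, a box `(−δ, 1+δ)ᵈ`, the chart `χ = φ ∘ ψ_c ∘ (·)^N` (again of
FORMAT, analytic on the box) and root functions `ζ_1, …, ζ_n` analytic on the box with
`P(χ(σ), T) = ∏_l (T − ζ_l(σ))` there, pairwise distinct over the open cube, and whose discriminant
product `∏_{l ≠ l'} (ζ_l − ζ_{l'})` is a pure monomial `σ^α` times an analytic unit (the input shape of
divisor lemmas for normal-crossing discriminants). The Abhyankar–Jung theorem enters ONLY as the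
explicit hypothesis `hAJ` (its statement for analytic coefficients near the closed cube); nothing is
asserted about it here (namespace `Literature.NumberTheory.Transcendental.JungPreparation`).

## References

* H. W. E. Jung, J. reine angew. Math. 133 (1908), 289–314; S. S. Abhyankar, Amer. J. Math. 77
  (1955), 575–592; J. Kollár, *Lectures on Resolution of Singularities* (2007), §2.3;
  A. Parusiński, G. Rond, J. Algebra 365 (2012), 29–41.
-/

noncomputable section

open Set Polynomial
open Literature.ModelTheory.ExponentialFields (IsSemialgebraic)
open Literature.Analysis.Calculus

namespace Literature.NumberTheory.Transcendental.JungPreparation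

variable {d : ℕ}

/-- A monic polynomial of degree `n`, mapped by a ring map, in the shape `Xⁿ + Σ_{k<n} C(a_k) Xᵏ`
used by the Abhyankar–Jung statement. [folklore] -/
theorem monic_map_eq_X_pow_add_sum {A R : Type*} [CommRing A] [CommRing R] [Nontrivial R]
    {P : A[X]} (hP : P.Monic) {n : ℕ} (hn : P.natDegree = n) (f : A →+* R) :
    P.map f = X ^ n + ∑ k : Fin n, C (f (P.coeff k)) * X ^ (k : ℕ) := by
  conv_lhs => rw [hP.as_sum, hn]
  rw [Polynomial.map_add, Polynomial.map_pow, map_X, Polynomial.map_sum, Finset.sum_range]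
  simp only [Polynomial.map_mul, Polynomial.map_pow, map_C, map_X]

/-- Base change of `Res(P, P')` for a monic `P` of degree `n` to a characteristic-zero domain.
[folklore] -/
theorem resultant_map_derivative {A R : Type*} [CommRing A] [CommRing R] [IsDomain R] [CharZero R]
    {P : A[X]} (hP : P.Monic) {n : ℕ} (hn : P.natDegree = n) (f : A →+* R) :
    (P.map f).resultant (derivative (P.map f)) =
      f (P.resultant (derivative P) n (n - 1)) := by
  have h1 : (P.map f).natDegree = n := by rw [hP.natDegree_map, hn]
  have h2 : (derivative (P.map f)).natDegree = n - 1 := by rw [natDegree_derivative, h1]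
  rw [← resultant_map_map, ← derivative_map, ← h2, ← h1]

/-- Base change of `Res(P, P')` in Sylvester format `n + (n − 1)`. [folklore] -/
theorem resultant_map_derivative' {A R : Type*} [CommRing A] [CommRing R]
    (P : A[X]) (n : ℕ) (f : A →+* R) :
    (P.map f).resultant (derivative (P.map f)) n (n - 1) =
      f (P.resultant (derivative P) n (n - 1)) := by
  rw [← resultant_map_map, ← derivative_map]

/-- `(∏_l (X − z_l))'(z_l) = ∏_{l' ≠ l} (z_l − z_{l'})`. [folklore] -/
theorem eval_derivative_prod_X_sub_C {K : Type*} [CommRing K] {n : ℕ} (z : Fin n → K) (l : Fin n) :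
    (derivative (∏ l', (X - C (z l')))).eval (z l) = ∏ l' ∈ Finset.univ.erase l, (z l - z l') := by
  classical
  rw [Finset.prod_eq_multiset_prod, derivative_prod, eval_multisetSum, Multiset.map_map]
  -- only the term `l' = l` survives
  have hval : ((Finset.univ : Finset (Fin n)).val.map
      (eval (z l) ∘ fun i => ((Finset.univ.val.erase i).map fun l' => X - C (z l')).prod *
        derivative (X - C (z i)))) =
      (Finset.univ : Finset (Fin n)).val.map fun i =>
        if i = l then ∏ l' ∈ Finset.univ.erase l, (z l - z l') else 0 := by
    refine Multiset.map_congr rfl fun i _ => ?_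
    simp only [Function.comp_apply, derivative_sub, derivative_X, derivative_C, sub_zero, mul_one,
      eval_multiset_prod, Multiset.map_map]
    split_ifs with hi
    · subst hi
      rw [Finset.prod_eq_multiset_prod, Finset.erase_val]
      simp
    · refine Multiset.prod_eq_zero ?_
      refine Multiset.mem_map.2 ⟨l, ?_, by simp⟩
      exact (Multiset.mem_erase_of_ne (Ne.symm hi)).2 (Finset.mem_univ_val _)
  rw [hval]
  change (∑ i, if i = l then ∏ l' ∈ Finset.univ.erase l, (z l - z l') else 0) = _
  simp

/-- The discriminant resultant of `∏_l (X − z_l)` is `∏_l ∏_{l' ≠ l} (z_l − z_{l'})`. [folklore] -/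
theorem resultant_prod_X_sub_C_derivative {K : Type*} [Field K] {n : ℕ} (z : Fin n → K) :
    (∏ l, (X - C (z l))).resultant (derivative (∏ l, (X - C (z l)))) n (n - 1) =
      ∏ l, ∏ l' ∈ Finset.univ.erase l, (z l - z l') := by
  classical
  have hmonic : (∏ l, (X - C (z l))).Monic := monic_prod_of_monic _ _ fun l _ => monic_X_sub_C _
  have hdeg : (∏ l, (X - C (z l))).natDegree = n := by
    rw [natDegree_prod_of_monic _ _ fun l _ => monic_X_sub_C _]
    simp
  have hsplit : (∏ l, (X - C (z l))).Splits := Splits.prod fun l _ => Splits.X_sub_C _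
  have hroots : (∏ l, (X - C (z l))).roots = (Finset.univ : Finset (Fin n)).val.map z := by
    rw [Finset.prod_eq_multiset_prod,
      show ((Finset.univ : Finset (Fin n)).val.map fun l => X - C (z l)) =
        ((Finset.univ : Finset (Fin n)).val.map z).map (fun a => X - C a) by rw [Multiset.map_map]; rfl,
      roots_multiset_prod_X_sub_C]
  have h := resultant_eq_prod_eval (∏ l, (X - C (z l))) (derivative (∏ l, (X - C (z l)))) (n - 1)
    ((natDegree_derivative_le _).trans (by rw [hdeg])) hsplit
  rw [hdeg] at h
  rw [h, hmonic.leadingCoeff, one_pow, one_mul, hroots, Multiset.map_map]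
  change ((Finset.univ : Finset (Fin n)).val.map fun l => (derivative (∏ l, (X - C (z l)))).eval (z l)).prod = _
  rw [← Finset.prod_eq_multiset_prod]
  exact Finset.prod_congr rfl fun l _ => eval_derivative_prod_X_sub_C z l

/-- If `∏_l ∏_{l' ≠ l} (z_l − z_{l'}) ≠ 0` then the `z_l` are pairwise distinct. [folklore] -/
theorem injective_of_prod_sub_ne_zero {K : Type*} [CommRing K] [IsDomain K] {n : ℕ} {z : Fin n → K}
    (h : ∏ l, ∏ l' ∈ Finset.univ.erase l, (z l - z l') ≠ 0) : Function.Injective z := by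
  intro l l' hll'
  by_contra hne
  apply h
  refine Finset.prod_eq_zero (Finset.mem_univ l) (Finset.prod_eq_zero ?_ (sub_eq_zero.2 hll'))
  exact Finset.mem_erase.2 ⟨Ne.symm hne, Finset.mem_univ _⟩

/-- **The prepared base chart.** See the module docstring. Inputs: the Abhyankar–Jung statement
`AJ(d)` (hypothesis `hAJ`, verbatim from the skeleton), a monic `P ∈ ℚ[x][T]` of degree `n` with
`D = Res(P, P')`, a FORMAT base chart `φ` with `D ∘ φ` a cube-monomial times a unit near the closed
cube, and a corner `c`. Output: `N ≥ 1`, `δ > 0`, the chart `χ = φ ∘ ψ_c ∘ (·)^N` (FORMAT, analytic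
on the box `(−δ,1+δ)ᵈ`), analytic roots `ζ_l` of `P(χ(σ), ·)` on the box, pairwise distinct over the
open cube, and the pure-monomial form of `∏_{l ≠ l'} (ζ_l − ζ_{l'})` (Jung 1908; Kollár 2007,
§2.3, with Abhyankar–Jung as a hypothesis). [folklore] -/
theorem exists_base_chart
    (hAJ : ∀ (n : ℕ) (U : Set (Fin d → ℝ)), IsOpen U →
      Set.pi Set.univ (fun _ : Fin d => Set.Icc (0:ℝ) 1) ⊆ U →
      ∀ (a : Fin n → (Fin d → ℝ) → ℝ) (α : Fin d → ℕ) (e : (Fin d → ℝ) → ℝ),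
      (∀ k, AnalyticOnNhd ℝ (a k) U) → AnalyticOnNhd ℝ e U → (∀ x ∈ U, e x ≠ 0) →
      (∀ x ∈ U, Polynomial.resultant (Polynomial.X ^ n + ∑ k : Fin n, Polynomial.C (a k (x)) *
        Polynomial.X ^ (k : ℕ)) (Polynomial.derivative (Polynomial.X ^ n + ∑ k : Fin n,
        Polynomial.C (a k (x)) * Polynomial.X ^ (k : ℕ))) = (∏ i, x i ^ α i) * e x) →
      ∃ N : ℕ, 0 < N ∧ ∃ V : Set (Fin d → ℝ), IsOpen V ∧
        Set.pi Set.univ (fun _ : Fin d => Set.Icc (0:ℝ) 1) ⊆ V ∧ (∀ σ ∈ V, (fun i => σ i ^ N) ∈ U) ∧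
        ∃ ζ : Fin n → (Fin d → ℝ) → ℂ, (∀ l, AnalyticOnNhd ℝ (ζ l) V) ∧
        ∀ σ ∈ V, ((Polynomial.X ^ n + ∑ k : Fin n, Polynomial.C (a k (fun i => σ i ^ N)) *
          Polynomial.X ^ (k : ℕ))).map (algebraMap ℝ ℂ) = ∏ l, (Polynomial.X - Polynomial.C (ζ l σ)))
    {P : (MvPolynomial (Fin d) ℚ)[X]} (hP : P.Monic) {n : ℕ} (hn : P.natDegree = n)
    {D : MvPolynomial (Fin d) ℚ} (hD : D = P.resultant (derivative P) n (n - 1))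
    (φ : (Fin d → ℝ) → (Fin d → ℝ))
    (hφa : AnalyticOnNhd ℝ φ (Set.pi Set.univ (fun _ : Fin d => Icc (0 : ℝ) 1)))
    (hφs : IsSemialgebraicMapOn ℚ (Set.pi Set.univ (fun _ : Fin d => Ioo (0 : ℝ) 1)) φ)
    (hφi : InjOn φ (Set.pi Set.univ (fun _ : Fin d => Ioo (0 : ℝ) 1)))
    (hφd : ∀ x ∈ Set.pi Set.univ (fun _ : Fin d => Ioo (0 : ℝ) 1), (fderiv ℝ φ x).det ≠ 0)
    {U₀ : Set (Fin d → ℝ)} (hU₀ : IsOpen U₀)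
    (hcubeU₀ : Set.pi Set.univ (fun _ : Fin d => Icc (0 : ℝ) 1) ⊆ U₀) (a b : Fin d → ℕ)
    {e₀ : (Fin d → ℝ) → ℝ} (he₀ : AnalyticOnNhd ℝ e₀ U₀) (he₀0 : ∀ x ∈ U₀, e₀ x ≠ 0)
    (hDφ : ∀ x ∈ U₀, MvPolynomial.aeval (φ x) D = (∏ i, x i ^ a i * (1 - x i) ^ b i) * e₀ x)
    (c : Fin d → Bool) :
    ∃ (N : ℕ) (δ : ℝ) (χ : (Fin d → ℝ) → (Fin d → ℝ)) (ζ : Fin n → (Fin d → ℝ) → ℂ)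
      (α : Fin d → ℕ) (E : (Fin d → ℝ) → ℂ),
      0 < N ∧ 0 < δ ∧
      (∀ σ, χ σ = φ (fun i => if c i then 1 - σ i ^ N / 2 else σ i ^ N / 2)) ∧
      (AnalyticOnNhd ℝ χ (Set.pi Set.univ (fun _ : Fin d => Icc (0 : ℝ) 1)) ∧
        IsSemialgebraicMapOn ℚ (Set.pi Set.univ (fun _ : Fin d => Ioo (0 : ℝ) 1)) χ ∧
        InjOn χ (Set.pi Set.univ (fun _ : Fin d => Ioo (0 : ℝ) 1)) ∧
        ∀ x ∈ Set.pi Set.univ (fun _ : Fin d => Ioo (0 : ℝ) 1), (fderiv ℝ χ x).det ≠ 0) ∧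
      AnalyticOnNhd ℝ χ (Set.pi Set.univ (fun _ : Fin d => Ioo (-δ) (1 + δ))) ∧
      (∀ l, AnalyticOnNhd ℝ (ζ l) (Set.pi Set.univ (fun _ : Fin d => Ioo (-δ) (1 + δ)))) ∧
      (∀ σ ∈ Set.pi Set.univ (fun _ : Fin d => Ioo (-δ) (1 + δ)),
        P.map ((algebraMap ℝ ℂ).comp (MvPolynomial.eval₂Hom (algebraMap ℚ ℝ) (χ σ))) =
          ∏ l, (X - C (ζ l σ))) ∧
      (∀ σ ∈ Set.pi Set.univ (fun _ : Fin d => Ioo (0 : ℝ) 1), Function.Injective fun l => ζ l σ) ∧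
      AnalyticOnNhd ℝ E (Set.pi Set.univ (fun _ : Fin d => Ioo (-δ) (1 + δ))) ∧
      (∀ σ ∈ Set.pi Set.univ (fun _ : Fin d => Ioo (-δ) (1 + δ)), E σ ≠ 0) ∧
      (∀ σ ∈ Set.pi Set.univ (fun _ : Fin d => Ioo (-δ) (1 + δ)),
        ∏ l, ∏ l' ∈ Finset.univ.erase l, (ζ l σ - ζ l' σ) = (∏ i, ((σ i : ℝ) : ℂ) ^ α i) * E σ) := by
  classical
  -- ### dyadic localisation of the discriminant (`N = 1` in the ramification slot)
  set ψ : (Fin d → ℝ) → (Fin d → ℝ) := fun y i => if c i then 1 - y i / 2 else y i / 2 with hψdef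
  have hψ : ∀ y i, ψ y i = if c i then 1 - y i / 2 else y i / 2 := fun y i => rfl
  set pw1 : (Fin d → ℝ) → (Fin d → ℝ) := fun y i => y i ^ 1 with hpw1def
  have hpw1 : ∀ σ i, pw1 σ i = σ i ^ 1 := fun σ i => rfl
  have hpw1id : ∀ y, pw1 y = y := fun y => funext fun i => pow_one _
  obtain ⟨U', e', hU'o, hcubeU', he'a, he'0, hmono⟩ := cubeMonomial_comp_dyadicRamified c 1 ψ pw1 hψ
    hpw1 (F := fun x => MvPolynomial.aeval (φ x) D) hU₀ hcubeU₀ a b he₀ he₀0 hDφ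
  simp only [hpw1id, Nat.one_mul] at hmono
  -- ### the Abhyankar–Jung data
  have hψa : ∀ y, AnalyticAt ℝ ψ y := fun y =>
    analyticAt_coordinatewise (g := fun i (t : ℝ) => if c i then 1 - t / 2 else t / 2) fun i => by
      split_ifs
      · exact analyticAt_const.sub (analyticAt_id.div analyticAt_const two_ne_zero)
      · exact analyticAt_id.div analyticAt_const two_ne_zero
  set U : Set (Fin d → ℝ) := U' ∩ {y | AnalyticAt ℝ (φ ∘ ψ) y} with hUdef
  have hUo : IsOpen U := hU'o.inter (isOpen_analyticAt ℝ (φ ∘ ψ))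
  have hcubeU : Set.pi Set.univ (fun _ : Fin d => Icc (0 : ℝ) 1) ⊆ U := fun y hy =>
    ⟨hcubeU' hy, (hφa _ (dyadic_mapsTo_Icc c ψ hψ hy)).comp (hψa y)⟩
  set evalR : (Fin d → ℝ) → MvPolynomial (Fin d) ℚ →+* ℝ := fun x =>
    MvPolynomial.eval₂Hom (algebraMap ℚ ℝ) x with hevalR
  have hevalR_apply : ∀ x q, evalR x q = MvPolynomial.aeval x q := fun x q => rfl
  set acoef : Fin n → (Fin d → ℝ) → ℝ := fun k y => evalR (φ (ψ y)) (P.coeff k) with hacoef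
  have hacoef_an : ∀ k, AnalyticOnNhd ℝ (acoef k) U := fun k y hy => by
    simp only [hacoef, hevalR_apply]
    exact AnalyticAt.aeval_mvPolynomial (fun i => (analyticAt_pi_iff.1 hy.2) i) _
  have hPmap : ∀ x : Fin d → ℝ, P.map (evalR x) =
      X ^ n + ∑ k : Fin n, C (evalR x (P.coeff k)) * X ^ (k : ℕ) := fun x =>
    monic_map_eq_X_pow_add_sum hP hn (evalR x)
  have hres : ∀ y ∈ U, Polynomial.resultant (X ^ n + ∑ k : Fin n, C (acoef k y) * X ^ (k : ℕ))
      (derivative (X ^ n + ∑ k : Fin n, C (acoef k y) * X ^ (k : ℕ))) =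
      (∏ i, y i ^ (if c i then b i else a i)) * e' y := by
    intro y hy
    have h1 : (X ^ n + ∑ k : Fin n, C (acoef k y) * X ^ (k : ℕ)) = P.map (evalR (φ (ψ y))) := by
      rw [hPmap]
    rw [h1, resultant_map_derivative hP hn, ← hD, hevalR_apply, ← hmono y hy.1]
  obtain ⟨N, hN, V, hVo, hcubeV, hpowU, ζ, hζa, hfac⟩ :=
    hAJ n U hUo hcubeU acoef (fun i => if c i then b i else a i) e' hacoef_an
      (fun y hy => he'a y hy.1) (fun y hy => he'0 y hy.1) hres
  -- ### the chart `χ = φ ∘ ψ ∘ (·)^N` and the box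
  set pw : (Fin d → ℝ) → (Fin d → ℝ) := fun σ i => σ i ^ N with hpwdef
  have hpw : ∀ σ i, pw σ i = σ i ^ N := fun σ i => rfl
  set χ : (Fin d → ℝ) → (Fin d → ℝ) := fun σ => φ (ψ (pw σ)) with hχdef
  have hχ : ∀ σ, χ σ = φ (ψ (pw σ)) := fun σ => rfl
  obtain ⟨hformat, -⟩ := dyadicRamified_format c N φ ψ pw χ hN hψ hpw hχ hφa hφs hφi hφd
  have hpwa : ∀ σ, AnalyticAt ℝ pw σ := fun σ =>
    analyticAt_coordinatewise (g := fun _ (t : ℝ) => t ^ N) fun i => analyticAt_id.pow N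
  have hχa : AnalyticOnNhd ℝ χ V := fun σ hσ =>
    AnalyticAt.comp (f := pw) (x := σ) (g := φ ∘ ψ) (hpowU σ hσ).2 (hpwa σ)
  obtain ⟨δ, hδ, hboxV⟩ := exists_box_subset hVo hcubeV
  -- ### the factorisation along `χ`
  have hfacP : ∀ σ ∈ V, P.map ((algebraMap ℝ ℂ).comp (evalR (χ σ))) = ∏ l, (X - C (ζ l σ)) := by
    intro σ hσ
    rw [← Polynomial.map_map, hPmap, ← hfac σ hσ]
  -- ### the discriminant along `χ` over `ℂ`
  set α : Fin d → ℕ := fun i => N * (if c i then b i else a i) with hαdef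
  set E : (Fin d → ℝ) → ℂ := fun σ => ((e' (pw σ) : ℝ) : ℂ) with hEdef
  have hEa : AnalyticOnNhd ℝ E V := fun σ hσ =>
    (Complex.ofRealCLM.analyticAt _).comp ((he'a _ (hpowU σ hσ).1).comp (hpwa σ))
  have hE0 : ∀ σ ∈ V, E σ ≠ 0 := fun σ hσ => Complex.ofReal_ne_zero.2 (he'0 _ (hpowU σ hσ).1)
  have hdisc : ∀ σ ∈ V, ∏ l, ∏ l' ∈ Finset.univ.erase l, (ζ l σ - ζ l' σ) =
      (∏ i, ((σ i : ℝ) : ℂ) ^ α i) * E σ := by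
    intro σ hσ
    rw [← resultant_prod_X_sub_C_derivative, ← hfacP σ hσ, resultant_map_derivative', ← hD,
      RingHom.comp_apply, hevalR_apply, hχ]
    have h := hmono (pw σ) (hpowU σ hσ).1
    rw [h]
    simp only [hEdef, hαdef, hpw, map_mul, map_prod, map_pow, Complex.coe_algebraMap, pow_mul]
  refine ⟨N, δ, χ, ζ, α, E, hN, hδ, fun σ => rfl, hformat, hχa.mono hboxV, fun l => (hζa l).mono hboxV,
    fun σ hσ => hfacP σ (hboxV hσ), fun σ hσ => ?_, hEa.mono hboxV, fun σ hσ => hE0 σ (hboxV hσ),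
    fun σ hσ => hdisc σ (hboxV hσ)⟩
  -- ### simple roots over the open cube
  have hσV : σ ∈ V := hboxV (pi_Ioo_subset_box hδ hσ)
  refine injective_of_prod_sub_ne_zero ?_
  rw [hdisc σ hσV]
  refine mul_ne_zero (Finset.prod_ne_zero_iff.2 fun i _ => pow_ne_zero _
    (Complex.ofReal_ne_zero.2 (hσ i (mem_univ _)).1.ne')) (hE0 σ hσV)

end Literature.NumberTheory.Transcendental.JungPreparation
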